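import Summits.CriticalPhenomena.CardyFormulaZ2.Theses.CardyTensorRG
import Summits.CriticalPhenomena.CardyFormulaZ2.Theorems.CardyTensorRGPolyominoGaussianLawStubDilatedCopy
import Summits.CriticalPhenomena.CardyFormulaZ2.Theorems.CardyTensorRGPolyominoGaussianLawStubScalingIdentity
import Summits.CriticalPhenomena.CardyFormulaZ2.Theorems.CardyTensorRGPolyominoGaussianLawStubDilationEquicontinuity
import Summits.CriticalPhenomena.CardyFormulaZ2.Theorems.CardyTensorRGPolyominoGaussianLawStubPolyominoRefinement
import Summits.CriticalPhenomena.CardyFormulaZ2.Theorems.CardyTensorRGPolyominoGaussianLawMeshEquicontinuity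
import Summits.CriticalPhenomena.CardyFormulaZ2.Theorems.CardyTensorRGPolyominoGaussianLawReduction
import Summits.CriticalPhenomena.CardyFormulaZ2.Theorems.CardyTensorRGPolyominoGaussianLawDyadicCores
import Summits.CriticalPhenomena.CardyFormulaZ2.Theorems.CardyTensorRGPolyominoGaussianLawOfCardy
import Summits.CriticalPhenomena.CardyFormulaZ2.Theorems.CardyTensorRGPolyominoGaussianLawUniversalLaw
import Summits.CriticalPhenomena.CardyFormulaZ2.Theorems.CardyTensorRGPolyominoGaussianLawSquareLimitPart4
import Summits.CriticalPhenomena.CardyFormulaZ2.Theorems.CardyWhiteToColouredSimilarityUpgradeStubSymmetricHalf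
import Summits.CriticalPhenomena.CardyFormulaZ2.Theorems.CardyIKTransportRenewalGridHarmlessModuli
import Summits.CriticalPhenomena.CardyFormulaZ2.Theorems.DyadicBetaRigidityDyadicBetaSufficesBeta
import Literature.Probability.RandomPlanarGeometry.ConformalRectangleProofs

/-!
# Birth skeleton (BC3) for the crux `PolyominoGaussianLaw`
# (stmt-CriticalPhenomena-14337, route `CardyTensorRG`, sub-problem `CardyFormulaZ2`)

Crux (fixed, by name): `Summit.CriticalPhenomena.CardyFormulaZ2.Theses.CardyTensorRG.PolyominoGaussianLaw` —
ONE exponent `a ∈ (0,1)` such that every POLYOMINO conformal rectangle `R` (carrier = interior of a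
finite union of closed `δ₀`-lattice squares, marks at `δ₀`-lattice points) has bond-`ℤ²` crossing
limit `I_a(η)` as the mesh `δ → 0⁺`, `I_a` the normalised symmetric incomplete beta function.

The skeleton cuts the crux along the seams the route itself names (TWO-LAYER PLAN / rreview gap
g20-25: "the limit along `δ₀·2^(−k)` and its Coulomb-gas form; coherence across all `δ` is the
flagged composite-blocking gap … plus RSW equicontinuity"):

* `stub_orbitLimitExists` — LimitExists ALONG THE BLOCKING ORBITS: for every polyomino
  representation `(δ₀, s)` of `R` with lattice marks and every `q ≥ 1`, the crossing probabilities
  along the `2×2`-blocking orbit of base mesh `δ₀/q`, i.e. at meshes `δ₀/(q·2^k)`, converge as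
  `k → ∞` (the RG's dynamical output: the gauge-fixed orbit of the finite open network converges —
  `GaussianSaddleCertificate` (b)(c) + `BoundaryTwistTensors`; polyomino shadow of `DyadicContraction`
  without the rate). OPEN (LPSA 1994); size XL.
* `stub_orbitLimitIsBetaLaw` — IDENTIFICATION: one `a ∈ (0,1)` such that whenever such an orbit
  limit exists it equals `I_a(cross-ratio)` (the fixed point reached is a point of the Gaussian line
  and the boundary/corner tensors are free-boson boundary fixed points ⇒ Coulomb-gas crossing law,
  covariant because a `D₄`-invariant stiffness is isotropic). OPEN; size XL; the CFT content.
* (v1) `stub_meshEquicontinuity` — RSW SCALE-EQUICONTINUITY IN THE MESH: for a polyomino conformal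
  rectangle, `|P(δ') − P(δ)| ≤ ε` whenever `0 < δ ≤ δ' ≤ ρ δ < δ₁` (`ρ = ρ(ε) > 1`, `δ₁ = δ₁(ε) > 0`).
  RESHAPED (lead seat c1, 2026-08-17, skeleton v2) into three registered stubs along the card's own
  mechanism "two nearby meshes = two nearby quads at one mesh":
  - `stub_dilatedCopy` — the dilate `t · R` (`t > 0`) of a conformal rectangle is a conformal rectangle
    with carrier `t · Ω` and arcs `t · (arc i)` (bookkeeping construction; size S);
  - `stub_scalingIdentity` — EXACT scale covariance of the discretisation:
    `discreteCrossingProb ½ (t·Ω) (t δ) (t·A) (t·B) = discreteCrossingProb ½ Ω δ A B` for `t > 0`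
    (mesh vertices / mesh graph / largest component / discrete arcs are literally the same subsets of
    `ℤ²`; size S–M);
  - `stub_dilationEquicontinuity` — the honest RSW residue: crossing probabilities of `R` and of its
    dilates `t · R`, `1/ρ ≤ t ≤ 1`, at the SAME mesh `δ < δ₁` differ by at most `ε`
    (Schramm–Smirnov 2011 Lemma 6.1 / Bollobás–Riordan Ch. 7 Lemma 14 technology for the discretised
    bond-ℤ² quad; size L; it gives NEITHER existence NOR the value of the limit).
  `meshEquicontinuity_of_dilation` (sorry-free, below) recovers v1's `stub_meshEquicontinuity` from the
  three: `P_R(δ') = P_{tR}(t δ') = P_{tR}(δ)` with `t = δ/δ' ∈ [1/ρ, 1]`.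

Assembly `PolyominoGaussianLaw_of` (real proof, ~90 lines): the orbit meshes `δ₀/(q·2^k)`,
`2^j ≤ q ≤ 2^(j+1)`, form a `(1 + 2^(−j))`-net of `(0, δ₀]` in logarithmic scale; finitely many
orbits per `j` give a uniform tail index, and mesh equicontinuity at ratio `ρ ≥ 1 + 2^(−j)` transports
the common orbit limit `I_a(η)` to the full one-sided limit `δ → 0⁺`
(`tendsto_nhdsWithin_zero_of_orbits`, pure real analysis, sorry-free).

Checks (planner skeleton-register seat, 2026-08-17): `lean check` rc 0, sorries = the 3 `stub_*` theorems
and nothing else; `#print axioms PolyominoGaussianLaw_of` = {propext, Classical.choice, Quot.sound};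
BC3 probes `stub → PolyominoGaussianLaw` and `stub → CardyFormulaZ2` by
`first | exact? | simpa | simpa using h | simpa [C] using h | (unfold C; simpa using h) | aesop` FAIL for all
three stubs (route file imported, and again with only the sub Statement + a verbatim crux def).
Disproof.lean: none exists yet for this crux (`ledger crux ls`), so no `_false_without_` obligation to honour.

Lead seat c2 (2026-08-17, skeleton v7 = v6 + this paragraph and the `example`s at the end; stubs unchanged):
landed around the two open cores, all `--supports` 14337 and imported above —
* LOSSLESSNESS (`…DyadicCores`): `stub_dyadicCutLossless : crux ↔ E ∧ I`, `stub_dyadicLawIff : crux ↔ D`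
  (D = ONE `a`, every dyadic orbit of every representation converges to `I_a(crossRatio x)`);
* POSITION (`…OfCardy`): `stub_ofCardyLatticePolygon` (sibling target 4781 ⇒ crux, `a = 2/3`),
  `stub_ofCardyFormulaZ2` (summit conjunct ⇒ crux), `not_cardyFormulaZ2_of_not`;
* SHAPE-FREENESS (`…UniversalLaw`): `stub_universalLawIff`, `stub_dyadicUniversalLawIff` — granted the route's
  own hypothesis `CardyRigidity` (stmt-0746), the crux is equivalent to the existence of SOME `F` continuous on
  `(0,1)` with [dyadic] polyomino crossing limits `F(cross-ratio)`: the `I_a` identification is automatic;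
* THE SQUARE (`…SquareLimitFrames/Part1–4`): `sq_tendsto_crossingProb_self` (`crossingProb half n n → 1/2`,
  new lattice theorem: self-duality below, Schramm–Smirnov continuity (5.1) above), `stub_unitSquareCores`
  (bond-`ℤ²` crossing probability of the unit square `→ 1/2` as `δ → 0⁺`, all meshes and every dyadic orbit),
  `stub_unitSquareBetaLaw` (the crux's law `I_a` holds on the marked unit square for EVERY `a < 1`),
  `sq_unitSquare_cardy` (Cardy's formula on bond-`ℤ²` for the unit square) — both cores hold where known
  technology reaches; general polyominoes need conformal covariance, the open content (13817/7100/14645).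

Lead seat c3 (2026-08-17, skeleton v8; the two cores unchanged and still the only load-bearing sorries):
three AUXILIARY registered stubs record what the tree's limit self-duality of the G02 discretisation
(`SimilarityUpgrade.Stubs.stub_dualSum`: `P_δ(Ω; arc 0, arc 2) + P_δ(Ω; arc 1, arc 3) → 1` for EVERY conformal
rectangle, landed 2026-08-17 by route `CardyWhiteToColoured`) gives for the two cores —
* `stub_symmetricClassBetaLaw` — on the LATTICE-SYMMETRIC class (a conformal rectangle invariant under an
  anti-linear lattice symmetry `σ z = u z̄`, `u ∈ {±1, ±i}`, exchanging the two arc pairs, fixing the marks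
  `a, c` and sending `b ↦ d`) the crux's conclusion `HasCrossingLimit … I_a` holds for EVERY `a < 1`
  (limit `1/2` by `stub_symmetricHalf`, modulus `1/2` by the symmetry principle, `I_a(1/2) = 1/2`);
* `stub_symmetricClassDyadic` — on the same class (arc-level symmetry only) every dyadic orbit converges, to `1/2`;
* `stub_coresShiftClosed` — BOTH cores are closed under the cyclic re-marking `R ↦ R⁺ = (Ω; b, c, d, a)`:
  a dyadic limit `L` of `R` forces the dyadic limit `1 - L` of `R⁺` (self-duality), and the identification
  `L = I_a(η)` at `R` forces it at `R⁺` (`η(R⁺) = 1 - η(R)`, `I_a(1 - η) = 1 - I_a(η)`).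
So both cores hold on every lattice-symmetric polyomino quad and on everything reachable from a known case by
re-marking; what is open is exactly the asymmetric, non-self-dual content (conformal covariance), as before.
-/

open Filter Topology Set

namespace Summit.CriticalPhenomena.CardyFormulaZ2.Cruxes.PolyominoGaussianLaw.Birth

/-! ### The stub statements as named `Prop`s (D-0027 §3.3 shape; skeleton v6)

`PolyominoGaussianLaw_of` takes the two OPEN registered propositions `Stubs.stub_dyadicLimitExists`, `Stubs.stub_dyadicLimitIsBetaLaw` BY NAME (skeleton v5; stubs 3–6 are theorems of the tree) (the declared
stubs of this Line, D-0027 §3.3; the `@[stub]` tag itself is gate-reserved, so admissibility is by the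
short name `stub_*`); the registered stubs `stub_*` below restate them verbatim (self-contained over tree
declarations) and are the only declarations of this file that use `sorry`; the final `example` checks
the two spellings agree definitionally. -/

namespace Stubs

/-- Stub `Prop` 1 (v4) — DYADIC LimitExists (registered stub: the theorem `stub_dyadicLimitExists` below). -/
def stub_dyadicLimitExists : Prop :=
  ∀ R : Literature.Probability.RandomPlanarGeometry.ConformalRectangle, ∀ δ₀ : ℝ, 0 < δ₀ →
      (∃ s : Finset (ℤ × ℤ), R.carrier = interior (⋃ p ∈ s, {z : ℂ | δ₀ * (p.1 : ℝ) ≤ z.re ∧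
        z.re ≤ δ₀ * ((p.1 : ℝ) + 1) ∧ δ₀ * (p.2 : ℝ) ≤ z.im ∧ z.im ≤ δ₀ * ((p.2 : ℝ) + 1)})) →
      (∀ i, ∃ m n : ℤ, R.pt i = (δ₀ : ℂ) * ((m : ℂ) + (n : ℂ) * Complex.I)) →
      ∃ L : ℝ, Filter.Tendsto
        (fun k : ℕ => Literature.Probability.Percolation.bondDomainCrossingProb R (δ₀ / 2 ^ k))
        Filter.atTop (nhds L)

/-- Stub `Prop` 2 (v4) — identification of DYADIC orbit limits as the beta law `I_a` (registered stub:
`stub_dyadicLimitIsBetaLaw` below). -/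
def stub_dyadicLimitIsBetaLaw : Prop :=
  ∃ a : ℝ, a ∈ Set.Ioo (0 : ℝ) 1 ∧
      ∀ R : Literature.Probability.RandomPlanarGeometry.ConformalRectangle, ∀ δ₀ : ℝ, 0 < δ₀ →
      (∃ s : Finset (ℤ × ℤ), R.carrier = interior (⋃ p ∈ s, {z : ℂ | δ₀ * (p.1 : ℝ) ≤ z.re ∧
        z.re ≤ δ₀ * ((p.1 : ℝ) + 1) ∧ δ₀ * (p.2 : ℝ) ≤ z.im ∧ z.im ≤ δ₀ * ((p.2 : ℝ) + 1)})) →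
      (∀ i, ∃ m n : ℤ, R.pt i = (δ₀ : ℂ) * ((m : ℂ) + (n : ℂ) * Complex.I)) →
      ∀ (φ : Literature.Probability.RandomPlanarGeometry.ConformalEquiv UpperHalfPlane.upperHalfPlaneSet R.carrier)
        (x : Fin 4 → ℝ), R.IsUniformizing φ x →
      ∀ L : ℝ, Filter.Tendsto
        (fun k : ℕ => Literature.Probability.Percolation.bondDomainCrossingProb R (δ₀ / 2 ^ k))
        Filter.atTop (nhds L) →
        L = intervalIntegral (fun s : ℝ => (s * (1 - s)) ^ (-a)) 0
              (Literature.Probability.RandomPlanarGeometry.crossRatio x) MeasureTheory.volume /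
            intervalIntegral (fun s : ℝ => (s * (1 - s)) ^ (-a)) 0 1 MeasureTheory.volume

/-- Stub `Prop` 6 (v4) — refinement of polyomino representations (registered stub:
`stub_polyominoRefinement` below). -/
def stub_polyominoRefinement : Prop :=
  ∀ R : Literature.Probability.RandomPlanarGeometry.ConformalRectangle, ∀ δ₀ : ℝ, 0 < δ₀ →
      (∃ s : Finset (ℤ × ℤ), R.carrier = interior (⋃ p ∈ s, {z : ℂ | δ₀ * (p.1 : ℝ) ≤ z.re ∧
        z.re ≤ δ₀ * ((p.1 : ℝ) + 1) ∧ δ₀ * (p.2 : ℝ) ≤ z.im ∧ z.im ≤ δ₀ * ((p.2 : ℝ) + 1)})) →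
      (∀ i, ∃ m n : ℤ, R.pt i = (δ₀ : ℂ) * ((m : ℂ) + (n : ℂ) * Complex.I)) →
      ∀ q : ℕ, 1 ≤ q →
        (∃ s : Finset (ℤ × ℤ), R.carrier = interior (⋃ p ∈ s, {z : ℂ |
          δ₀ / (q : ℝ) * (p.1 : ℝ) ≤ z.re ∧ z.re ≤ δ₀ / (q : ℝ) * ((p.1 : ℝ) + 1) ∧
          δ₀ / (q : ℝ) * (p.2 : ℝ) ≤ z.im ∧ z.im ≤ δ₀ / (q : ℝ) * ((p.2 : ℝ) + 1)})) ∧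
        ∀ i, ∃ m n : ℤ, R.pt i = ((δ₀ / (q : ℝ) : ℝ) : ℂ) * ((m : ℂ) + (n : ℂ) * Complex.I)

/-- (v1–v3, now DERIVED — see `orbitLimitExists_of_dyadic`) orbit LimitExists along all blocking orbits `δ₀/(q·2^k)`. -/
def orbitLimitExists : Prop :=
  ∀ R : Literature.Probability.RandomPlanarGeometry.ConformalRectangle, ∀ δ₀ : ℝ, 0 < δ₀ →
      (∃ s : Finset (ℤ × ℤ), R.carrier = interior (⋃ p ∈ s, {z : ℂ | δ₀ * (p.1 : ℝ) ≤ z.re ∧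
        z.re ≤ δ₀ * ((p.1 : ℝ) + 1) ∧ δ₀ * (p.2 : ℝ) ≤ z.im ∧ z.im ≤ δ₀ * ((p.2 : ℝ) + 1)})) →
      (∀ i, ∃ m n : ℤ, R.pt i = (δ₀ : ℂ) * ((m : ℂ) + (n : ℂ) * Complex.I)) →
      ∀ q : ℕ, 1 ≤ q → ∃ L : ℝ, Filter.Tendsto
        (fun k : ℕ => Literature.Probability.Percolation.bondDomainCrossingProb R (δ₀ / ((q : ℝ) * 2 ^ k)))
        Filter.atTop (nhds L)

/-- (v1–v3, now DERIVED — see `orbitLimitIsBetaLaw_of_dyadic`) identification of all orbit limits as `I_a`. -/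
def orbitLimitIsBetaLaw : Prop :=
  ∃ a : ℝ, a ∈ Set.Ioo (0 : ℝ) 1 ∧
      ∀ R : Literature.Probability.RandomPlanarGeometry.ConformalRectangle, ∀ δ₀ : ℝ, 0 < δ₀ →
      (∃ s : Finset (ℤ × ℤ), R.carrier = interior (⋃ p ∈ s, {z : ℂ | δ₀ * (p.1 : ℝ) ≤ z.re ∧
        z.re ≤ δ₀ * ((p.1 : ℝ) + 1) ∧ δ₀ * (p.2 : ℝ) ≤ z.im ∧ z.im ≤ δ₀ * ((p.2 : ℝ) + 1)})) →
      (∀ i, ∃ m n : ℤ, R.pt i = (δ₀ : ℂ) * ((m : ℂ) + (n : ℂ) * Complex.I)) →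
      ∀ (φ : Literature.Probability.RandomPlanarGeometry.ConformalEquiv UpperHalfPlane.upperHalfPlaneSet R.carrier)
        (x : Fin 4 → ℝ), R.IsUniformizing φ x →
      ∀ q : ℕ, 1 ≤ q → ∀ L : ℝ, Filter.Tendsto
        (fun k : ℕ => Literature.Probability.Percolation.bondDomainCrossingProb R (δ₀ / ((q : ℝ) * 2 ^ k)))
        Filter.atTop (nhds L) →
        L = intervalIntegral (fun s : ℝ => (s * (1 - s)) ^ (-a)) 0
              (Literature.Probability.RandomPlanarGeometry.crossRatio x) MeasureTheory.volume /
            intervalIntegral (fun s : ℝ => (s * (1 - s)) ^ (-a)) 0 1 MeasureTheory.volume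

/-- Stub `Prop` 3 — dilated copies of conformal rectangles (registered stub: `stub_dilatedCopy` below). -/
def stub_dilatedCopy : Prop :=
  ∀ R : Literature.Probability.RandomPlanarGeometry.ConformalRectangle, ∀ t : ℝ, 0 < t →
      ∃ R' : Literature.Probability.RandomPlanarGeometry.ConformalRectangle,
        R'.carrier = (fun z : ℂ => (t : ℂ) * z) '' R.carrier ∧
          ∀ i, R'.arc i = (fun z : ℂ => (t : ℂ) * z) '' R.arc i

/-- Stub `Prop` 4 — exact scale covariance of the discretised crossing probability (registered stub:
`stub_scalingIdentity` below). -/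
def stub_scalingIdentity : Prop :=
  ∀ (Ω A B : Set ℂ) (δ t : ℝ), 0 < t →
      Literature.Probability.Percolation.discreteCrossingProb Literature.Probability.Percolation.half
          ((fun z : ℂ => (t : ℂ) * z) '' Ω) (t * δ) ((fun z : ℂ => (t : ℂ) * z) '' A)
          ((fun z : ℂ => (t : ℂ) * z) '' B) =
        Literature.Probability.Percolation.discreteCrossingProb Literature.Probability.Percolation.half Ω δ A B

/-- Stub `Prop` 5 — RSW dilation-equicontinuity at fixed mesh (registered stub:
`stub_dilationEquicontinuity` below). -/
def stub_dilationEquicontinuity : Prop :=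
  ∀ R : Literature.Probability.RandomPlanarGeometry.ConformalRectangle,
      (∃ δ₀ : ℝ, 0 < δ₀ ∧ (∃ s : Finset (ℤ × ℤ), R.carrier = interior (⋃ p ∈ s, {z : ℂ |
        δ₀ * (p.1 : ℝ) ≤ z.re ∧ z.re ≤ δ₀ * ((p.1 : ℝ) + 1) ∧ δ₀ * (p.2 : ℝ) ≤ z.im ∧
        z.im ≤ δ₀ * ((p.2 : ℝ) + 1)})) ∧ ∀ i, ∃ m n : ℤ, R.pt i = (δ₀ : ℂ) * ((m : ℂ) + (n : ℂ) * Complex.I)) →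
      ∀ ε : ℝ, 0 < ε → ∃ ρ : ℝ, 1 < ρ ∧ ∃ δ₁ : ℝ, 0 < δ₁ ∧ ∀ t : ℝ, 1 / ρ ≤ t → t ≤ 1 →
        ∀ R' : Literature.Probability.RandomPlanarGeometry.ConformalRectangle,
          R'.carrier = (fun z : ℂ => (t : ℂ) * z) '' R.carrier →
          R'.arc 0 = (fun z : ℂ => (t : ℂ) * z) '' R.arc 0 →
          R'.arc 2 = (fun z : ℂ => (t : ℂ) * z) '' R.arc 2 →
        ∀ δ : ℝ, 0 < δ → δ < δ₁ →
          |Literature.Probability.Percolation.bondDomainCrossingProb R' δ -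
            Literature.Probability.Percolation.bondDomainCrossingProb R δ| ≤ ε

/-- (v1, now DERIVED — see `meshEquicontinuity_of_dilation`) RSW scale-equicontinuity in the mesh. -/
def meshEquicontinuity : Prop :=
  ∀ R : Literature.Probability.RandomPlanarGeometry.ConformalRectangle,
      (∃ δ₀ : ℝ, 0 < δ₀ ∧ (∃ s : Finset (ℤ × ℤ), R.carrier = interior (⋃ p ∈ s, {z : ℂ |
        δ₀ * (p.1 : ℝ) ≤ z.re ∧ z.re ≤ δ₀ * ((p.1 : ℝ) + 1) ∧ δ₀ * (p.2 : ℝ) ≤ z.im ∧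
        z.im ≤ δ₀ * ((p.2 : ℝ) + 1)})) ∧ ∀ i, ∃ m n : ℤ, R.pt i = (δ₀ : ℂ) * ((m : ℂ) + (n : ℂ) * Complex.I)) →
      ∀ ε : ℝ, 0 < ε → ∃ ρ : ℝ, 1 < ρ ∧ ∃ δ₁ : ℝ, 0 < δ₁ ∧ ∀ δ δ' : ℝ, 0 < δ → δ ≤ δ' → δ' ≤ ρ * δ →
        δ' < δ₁ → |Literature.Probability.Percolation.bondDomainCrossingProb R δ' -
          Literature.Probability.Percolation.bondDomainCrossingProb R δ| ≤ ε

/-- Auxiliary stub `Prop` 7 (v8) — the crux's law on the LATTICE-SYMMETRIC class, every exponent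
(registered stub: `stub_symmetricClassBetaLaw` below). -/
def stub_symmetricClassBetaLaw : Prop :=
  ∀ (R : Literature.Probability.RandomPlanarGeometry.ConformalRectangle) (u : ℂ),
    (u = 1 ∨ u = -1 ∨ u = Complex.I ∨ u = -Complex.I) →
    (fun z : ℂ => u * (starRingEnd ℂ) z) '' R.carrier = R.carrier →
    ((fun z : ℂ => u * (starRingEnd ℂ) z) '' R.arc 0 = R.arc 1 ∧
        (fun z : ℂ => u * (starRingEnd ℂ) z) '' R.arc 2 = R.arc 3 ∨
      (fun z : ℂ => u * (starRingEnd ℂ) z) '' R.arc 0 = R.arc 3 ∧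
        (fun z : ℂ => u * (starRingEnd ℂ) z) '' R.arc 2 = R.arc 1) →
    u * (starRingEnd ℂ) (R.pt 0) = R.pt 0 → u * (starRingEnd ℂ) (R.pt 2) = R.pt 2 →
    u * (starRingEnd ℂ) (R.pt 1) = R.pt 3 →
    ∀ a : ℝ, a < 1 →
      R.HasCrossingLimit (Literature.Probability.Percolation.bondDomainCrossingProb R)
        (fun η : ℝ => intervalIntegral (fun s : ℝ => (s * (1 - s)) ^ (-a)) 0 η MeasureTheory.volume /
          intervalIntegral (fun s : ℝ => (s * (1 - s)) ^ (-a)) 0 1 MeasureTheory.volume)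

/-- Auxiliary stub `Prop` 8 (v8) — dyadic orbits on the lattice-symmetric class converge to `1/2`
(registered stub: `stub_symmetricClassDyadic` below). -/
def stub_symmetricClassDyadic : Prop :=
  ∀ (R : Literature.Probability.RandomPlanarGeometry.ConformalRectangle) (u : ℂ),
    (u = 1 ∨ u = -1 ∨ u = Complex.I ∨ u = -Complex.I) →
    (fun z : ℂ => u * (starRingEnd ℂ) z) '' R.carrier = R.carrier →
    ((fun z : ℂ => u * (starRingEnd ℂ) z) '' R.arc 0 = R.arc 1 ∧
        (fun z : ℂ => u * (starRingEnd ℂ) z) '' R.arc 2 = R.arc 3 ∨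
      (fun z : ℂ => u * (starRingEnd ℂ) z) '' R.arc 0 = R.arc 3 ∧
        (fun z : ℂ => u * (starRingEnd ℂ) z) '' R.arc 2 = R.arc 1) →
    ∀ δ₀ : ℝ, 0 < δ₀ →
      Filter.Tendsto (fun k : ℕ => Literature.Probability.Percolation.bondDomainCrossingProb R (δ₀ / 2 ^ k))
        Filter.atTop (nhds (1 / 2))

/-- Auxiliary stub `Prop` 9 (v8) — both cores are closed under the cyclic re-marking
`R = (Ω; a, b, c, d) ↦ R⁺ = (Ω; b, c, d, a)` (registered stub: `stub_coresShiftClosed` below). -/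
def stub_coresShiftClosed : Prop :=
  ∀ R R' : Literature.Probability.RandomPlanarGeometry.ConformalRectangle, R'.carrier = R.carrier →
    (∀ i, R'.pt i = R.pt (i + 1)) → R'.arc 0 = R.arc 1 → R'.arc 2 = R.arc 3 → ∀ δ₀ : ℝ, 0 < δ₀ →
    (∀ L : ℝ, Filter.Tendsto
        (fun k : ℕ => Literature.Probability.Percolation.bondDomainCrossingProb R (δ₀ / 2 ^ k))
        Filter.atTop (nhds L) →
      Filter.Tendsto
        (fun k : ℕ => Literature.Probability.Percolation.bondDomainCrossingProb R' (δ₀ / 2 ^ k))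
        Filter.atTop (nhds (1 - L))) ∧
    ∀ a : ℝ, a < 1 →
      (∀ (φ : Literature.Probability.RandomPlanarGeometry.ConformalEquiv UpperHalfPlane.upperHalfPlaneSet R.carrier)
          (x : Fin 4 → ℝ), R.IsUniformizing φ x →
        ∀ L : ℝ, Filter.Tendsto
          (fun k : ℕ => Literature.Probability.Percolation.bondDomainCrossingProb R (δ₀ / 2 ^ k))
          Filter.atTop (nhds L) →
          L = intervalIntegral (fun s : ℝ => (s * (1 - s)) ^ (-a)) 0
                (Literature.Probability.RandomPlanarGeometry.crossRatio x) MeasureTheory.volume /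
              intervalIntegral (fun s : ℝ => (s * (1 - s)) ^ (-a)) 0 1 MeasureTheory.volume) →
      ∀ (φ' : Literature.Probability.RandomPlanarGeometry.ConformalEquiv UpperHalfPlane.upperHalfPlaneSet R'.carrier)
        (x' : Fin 4 → ℝ), R'.IsUniformizing φ' x' →
      ∀ L' : ℝ, Filter.Tendsto
        (fun k : ℕ => Literature.Probability.Percolation.bondDomainCrossingProb R' (δ₀ / 2 ^ k))
        Filter.atTop (nhds L') →
        L' = intervalIntegral (fun s : ℝ => (s * (1 - s)) ^ (-a)) 0
              (Literature.Probability.RandomPlanarGeometry.crossRatio x') MeasureTheory.volume /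
            intervalIntegral (fun s : ℝ => (s * (1 - s)) ^ (-a)) 0 1 MeasureTheory.volume

end Stubs

/-! ### The registered stubs (the ONLY sorries of the file) -/

/-- stub 1 (v4: DYADIC LimitExists; RG dynamics). For every polyomino representation `(δ₀, s)` with
lattice marks of a conformal rectangle `R`, the bond-ℤ² crossing probabilities of `R` along the pure
`2×2`-blocking orbit of meshes `δ₀ · 2^(−k)` converge as `k → ∞`. -/
theorem stub_dyadicLimitExists :
    ∀ R : Literature.Probability.RandomPlanarGeometry.ConformalRectangle, ∀ δ₀ : ℝ, 0 < δ₀ →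
      (∃ s : Finset (ℤ × ℤ), R.carrier = interior (⋃ p ∈ s, {z : ℂ | δ₀ * (p.1 : ℝ) ≤ z.re ∧
        z.re ≤ δ₀ * ((p.1 : ℝ) + 1) ∧ δ₀ * (p.2 : ℝ) ≤ z.im ∧ z.im ≤ δ₀ * ((p.2 : ℝ) + 1)})) →
      (∀ i, ∃ m n : ℤ, R.pt i = (δ₀ : ℂ) * ((m : ℂ) + (n : ℂ) * Complex.I)) →
      ∃ L : ℝ, Filter.Tendsto
        (fun k : ℕ => Literature.Probability.Percolation.bondDomainCrossingProb R (δ₀ / 2 ^ k))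
        Filter.atTop (nhds L) := by
  sorry

/-- stub 2 (v4: identification of DYADIC orbit limits as the Coulomb-gas / beta law; the CFT content).
There is ONE exponent `a ∈ (0,1)` such that for every polyomino representation with lattice marks of a
conformal rectangle `R` and every uniformizing datum `(φ, x)`: if the crossing probabilities along the
orbit `δ₀ · 2^(−k)` converge to `L`, then `L = I_a(crossRatio x)`. -/
theorem stub_dyadicLimitIsBetaLaw :
    ∃ a : ℝ, a ∈ Set.Ioo (0 : ℝ) 1 ∧
      ∀ R : Literature.Probability.RandomPlanarGeometry.ConformalRectangle, ∀ δ₀ : ℝ, 0 < δ₀ →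
      (∃ s : Finset (ℤ × ℤ), R.carrier = interior (⋃ p ∈ s, {z : ℂ | δ₀ * (p.1 : ℝ) ≤ z.re ∧
        z.re ≤ δ₀ * ((p.1 : ℝ) + 1) ∧ δ₀ * (p.2 : ℝ) ≤ z.im ∧ z.im ≤ δ₀ * ((p.2 : ℝ) + 1)})) →
      (∀ i, ∃ m n : ℤ, R.pt i = (δ₀ : ℂ) * ((m : ℂ) + (n : ℂ) * Complex.I)) →
      ∀ (φ : Literature.Probability.RandomPlanarGeometry.ConformalEquiv UpperHalfPlane.upperHalfPlaneSet R.carrier)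
        (x : Fin 4 → ℝ), R.IsUniformizing φ x →
      ∀ L : ℝ, Filter.Tendsto
        (fun k : ℕ => Literature.Probability.Percolation.bondDomainCrossingProb R (δ₀ / 2 ^ k))
        Filter.atTop (nhds L) →
        L = intervalIntegral (fun s : ℝ => (s * (1 - s)) ^ (-a)) 0
              (Literature.Probability.RandomPlanarGeometry.crossRatio x) MeasureTheory.volume /
            intervalIntegral (fun s : ℝ => (s * (1 - s)) ^ (-a)) 0 1 MeasureTheory.volume := by
  sorry

/-! ### Auxiliary registered stubs (v8, lead c3): the self-dual part of the two cores

What the tree's limit self-duality `SimilarityUpgrade.Stubs.stub_dualSum` (with the exact lattice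
symmetries `stub_symmetricHalf`, the symmetry principle `crossRatio_eq_half_of_antiAffine`, the modulus of
the re-marked rectangle `crossRatio_eq_one_sub_of_pt_eq_succ` and the beta symmetry `betaLaw_one_sub`)
gives for `stub_dyadicLimitExists` / `stub_dyadicLimitIsBetaLaw`: both hold on the lattice-symmetric class,
and both are closed under cyclic re-marking. Genuine partial results; they do not feed `PolyominoGaussianLaw_of`. -/

/-- aux stub 7 (v8). **The crux's law holds, for EVERY exponent `a < 1`, on every lattice-symmetric
conformal rectangle**: if `σ z = u z̄` (`u ∈ {1, -1, i, -i}`) preserves the carrier of `R = (Ω; a, b, c, d)`,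
exchanges the two pairs of opposite arcs, fixes `a`, `c` and maps `b ↦ d`, then
`bondDomainCrossingProb R δ → I_a(crossRatio x) = I_a(1/2) = 1/2` for every uniformizing datum. -/
theorem stub_symmetricClassBetaLaw :
    ∀ (R : Literature.Probability.RandomPlanarGeometry.ConformalRectangle) (u : ℂ),
      (u = 1 ∨ u = -1 ∨ u = Complex.I ∨ u = -Complex.I) →
      (fun z : ℂ => u * (starRingEnd ℂ) z) '' R.carrier = R.carrier →
      ((fun z : ℂ => u * (starRingEnd ℂ) z) '' R.arc 0 = R.arc 1 ∧
          (fun z : ℂ => u * (starRingEnd ℂ) z) '' R.arc 2 = R.arc 3 ∨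
        (fun z : ℂ => u * (starRingEnd ℂ) z) '' R.arc 0 = R.arc 3 ∧
          (fun z : ℂ => u * (starRingEnd ℂ) z) '' R.arc 2 = R.arc 1) →
      u * (starRingEnd ℂ) (R.pt 0) = R.pt 0 → u * (starRingEnd ℂ) (R.pt 2) = R.pt 2 →
      u * (starRingEnd ℂ) (R.pt 1) = R.pt 3 →
      ∀ a : ℝ, a < 1 →
        R.HasCrossingLimit (Literature.Probability.Percolation.bondDomainCrossingProb R)
          (fun η : ℝ => intervalIntegral (fun s : ℝ => (s * (1 - s)) ^ (-a)) 0 η MeasureTheory.volume /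
            intervalIntegral (fun s : ℝ => (s * (1 - s)) ^ (-a)) 0 1 MeasureTheory.volume) := by
  sorry

/-- aux stub 8 (v8). **Dyadic orbits of lattice-symmetric conformal rectangles converge to `1/2`**
(arc-level symmetry only): the full limit `1/2` of `stub_symmetricHalf` read along `δ₀ · 2^(−k)`. -/
theorem stub_symmetricClassDyadic :
    ∀ (R : Literature.Probability.RandomPlanarGeometry.ConformalRectangle) (u : ℂ),
      (u = 1 ∨ u = -1 ∨ u = Complex.I ∨ u = -Complex.I) →
      (fun z : ℂ => u * (starRingEnd ℂ) z) '' R.carrier = R.carrier →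
      ((fun z : ℂ => u * (starRingEnd ℂ) z) '' R.arc 0 = R.arc 1 ∧
          (fun z : ℂ => u * (starRingEnd ℂ) z) '' R.arc 2 = R.arc 3 ∨
        (fun z : ℂ => u * (starRingEnd ℂ) z) '' R.arc 0 = R.arc 3 ∧
          (fun z : ℂ => u * (starRingEnd ℂ) z) '' R.arc 2 = R.arc 1) →
      ∀ δ₀ : ℝ, 0 < δ₀ →
        Filter.Tendsto (fun k : ℕ => Literature.Probability.Percolation.bondDomainCrossingProb R (δ₀ / 2 ^ k))
          Filter.atTop (nhds (1 / 2)) := by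
  sorry

/-- aux stub 9 (v8). **Both cores are closed under cyclic re-marking.** For `R = (Ω; a, b, c, d)` and its
re-marking `R' = (Ω; b, c, d, a)` (same carrier, marks and arcs shifted by one) and every `δ₀ > 0`:
(E) if the dyadic orbit of `R` converges to `L`, that of `R'` converges to `1 - L` (limit self-duality
`stub_dualSum`: the crossing of `R'` is the dual crossing of `R`); (I) if every dyadic limit of `R` is
`I_a(η_R)`, then every dyadic limit of `R'` is `I_a(η_{R'})`, because `η_{R'} = 1 - η_R`
(`crossRatio_eq_one_sub_of_pt_eq_succ`) and `I_a(1 - η) = 1 - I_a(η)` (`betaLaw_one_sub`). -/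
theorem stub_coresShiftClosed :
    ∀ R R' : Literature.Probability.RandomPlanarGeometry.ConformalRectangle, R'.carrier = R.carrier →
      (∀ i, R'.pt i = R.pt (i + 1)) → R'.arc 0 = R.arc 1 → R'.arc 2 = R.arc 3 → ∀ δ₀ : ℝ, 0 < δ₀ →
      (∀ L : ℝ, Filter.Tendsto
          (fun k : ℕ => Literature.Probability.Percolation.bondDomainCrossingProb R (δ₀ / 2 ^ k))
          Filter.atTop (nhds L) →
        Filter.Tendsto
          (fun k : ℕ => Literature.Probability.Percolation.bondDomainCrossingProb R' (δ₀ / 2 ^ k))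
          Filter.atTop (nhds (1 - L))) ∧
      ∀ a : ℝ, a < 1 →
        (∀ (φ : Literature.Probability.RandomPlanarGeometry.ConformalEquiv UpperHalfPlane.upperHalfPlaneSet R.carrier)
            (x : Fin 4 → ℝ), R.IsUniformizing φ x →
          ∀ L : ℝ, Filter.Tendsto
            (fun k : ℕ => Literature.Probability.Percolation.bondDomainCrossingProb R (δ₀ / 2 ^ k))
            Filter.atTop (nhds L) →
            L = intervalIntegral (fun s : ℝ => (s * (1 - s)) ^ (-a)) 0
                  (Literature.Probability.RandomPlanarGeometry.crossRatio x) MeasureTheory.volume /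
                intervalIntegral (fun s : ℝ => (s * (1 - s)) ^ (-a)) 0 1 MeasureTheory.volume) →
        ∀ (φ' : Literature.Probability.RandomPlanarGeometry.ConformalEquiv UpperHalfPlane.upperHalfPlaneSet R'.carrier)
          (x' : Fin 4 → ℝ), R'.IsUniformizing φ' x' →
        ∀ L' : ℝ, Filter.Tendsto
          (fun k : ℕ => Literature.Probability.Percolation.bondDomainCrossingProb R' (δ₀ / 2 ^ k))
          Filter.atTop (nhds L') →
          L' = intervalIntegral (fun s : ℝ => (s * (1 - s)) ^ (-a)) 0
                (Literature.Probability.RandomPlanarGeometry.crossRatio x') MeasureTheory.volume /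
              intervalIntegral (fun s : ℝ => (s * (1 - s)) ^ (-a)) 0 1 MeasureTheory.volume := by
  sorry

/-! ### Stubs 3–6 and v1's mesh equicontinuity are THEOREMS of the tree (lead seat c1, 2026-08-17):
`stub_polyominoRefinement` (…StubPolyominoRefinement.lean), `stub_meshEquicontinuity` (…MeshEquicontinuity.lean, p148479),
`stub_dilatedCopy` (…Theorems/CardyTensorRGPolyominoGaussianLawStubDilatedCopy.lean, p143521),
`stub_scalingIdentity` (…StubScalingIdentity.lean, p143806),
`stub_dilationEquicontinuity` (…StubDilationEquicontinuity.lean + Part1–4, p146338; Schramm–Smirnov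
continuity (5.1) for bond-ℤ², `SchrammSmirnov2011_lemma_5_1_holds` + `Quad.continuity_uniform_pair`, and a
deterministic sandwich between H21's discrete-arc crossing events and SS quad-crossing events of a square
model of the polyomino) — imported above, same names, same namespace; their `sorry`s are gone. -/

/-! ### Assembly (sorry-free) -/

/-! `tendsto_nhdsWithin_zero_of_orbits` (the log-scale net lemma) now lives in the tree:
`…Theorems/CardyTensorRGPolyominoGaussianLawReduction.lean` (p151231), imported above, together with the
registered reduction `stub_reductionToDyadic : dyadic LimitExists → dyadic identification → crux`. -/

/-- **Mesh equicontinuity from dilation equicontinuity** (v1's `stub_meshEquicontinuity`, now derived,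
sorry-free): with `t = δ/δ' ∈ [1/ρ, 1]`, `P_R(δ') = P_{t·R}(t δ') = P_{t·R}(δ)` by the exact scaling
identity applied to the dilated copy `t·R`, and `|P_{t·R}(δ) − P_R(δ)| ≤ ε` at the common mesh `δ < δ₁`. -/
theorem meshEquicontinuity_of_dilation (hD : Stubs.stub_dilatedCopy) (hS : Stubs.stub_scalingIdentity)
    (hE : Stubs.stub_dilationEquicontinuity) : Stubs.meshEquicontinuity := by
  intro R hR ε hε
  obtain ⟨ρ, hρ, δ₁, hδ₁, h⟩ := hE R hR ε hε
  refine ⟨ρ, hρ, δ₁, hδ₁, fun δ δ' hδ hle hle' hlt => ?_⟩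
  have hδ' : 0 < δ' := lt_of_lt_of_le hδ hle
  have hρ0 : 0 < ρ := lt_trans one_pos hρ
  set t : ℝ := δ / δ' with ht_def
  have ht : 0 < t := div_pos hδ hδ'
  have ht1 : t ≤ 1 := (div_le_one hδ').2 hle
  have htρ : 1 / ρ ≤ t := by
    rw [ht_def, div_le_div_iff₀ hρ0 hδ', one_mul]
    linarith [hle']
  obtain ⟨R', hcar, harc⟩ := hD R t ht
  have htδ : t * δ' = δ := by
    rw [ht_def]; field_simp
  have key : Literature.Probability.Percolation.bondDomainCrossingProb R δ' =
      Literature.Probability.Percolation.bondDomainCrossingProb R' δ := by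
    have hs := hS R.carrier (R.arc 0) (R.arc 2) δ' t ht
    rw [htδ] at hs
    unfold Literature.Probability.Percolation.bondDomainCrossingProb
    rw [hcar, harc 0, harc 2]
    exact hs.symm
  rw [key]
  exact h t htρ ht1 R' hcar (harc 0) (harc 2) δ hδ (lt_of_le_of_lt hle hlt)

/-- **All blocking orbits from the dyadic ones** (v4): the orbit `δ₀/(q·2^k)` of the representation
`(δ₀, s)` is the pure dyadic orbit of the refined representation at spacing `δ₀/q`
(`stub_polyominoRefinement`), since `δ₀ / (q · 2^k) = (δ₀/q) / 2^k`. -/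
theorem orbitLimitExists_of_dyadic (hP : Stubs.stub_polyominoRefinement)
    (hE : Stubs.stub_dyadicLimitExists) : Stubs.orbitLimitExists := by
  intro R δ₀ hδ₀ hs hmarks q hq
  have hq0 : (0 : ℝ) < q := by exact_mod_cast hq
  obtain ⟨hs', hmarks'⟩ := hP R δ₀ hδ₀ hs hmarks q hq
  obtain ⟨L, hL⟩ := hE R (δ₀ / (q : ℝ)) (div_pos hδ₀ hq0) hs' hmarks'
  refine ⟨L, ?_⟩
  have heq : (fun k : ℕ => Literature.Probability.Percolation.bondDomainCrossingProb R (δ₀ / ((q : ℝ) * 2 ^ k))) =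
      fun k : ℕ => Literature.Probability.Percolation.bondDomainCrossingProb R (δ₀ / (q : ℝ) / 2 ^ k) := by
    funext k
    rw [div_div]
  rw [heq]
  exact hL

/-- **Identification of all orbit limits from the dyadic identification** (v4), by the same refinement. -/
theorem orbitLimitIsBetaLaw_of_dyadic (hP : Stubs.stub_polyominoRefinement)
    (hI : Stubs.stub_dyadicLimitIsBetaLaw) : Stubs.orbitLimitIsBetaLaw := by
  obtain ⟨a, ha, hIa⟩ := hI
  refine ⟨a, ha, ?_⟩
  intro R δ₀ hδ₀ hs hmarks φ x hφ q hq L hL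
  have hq0 : (0 : ℝ) < q := by exact_mod_cast hq
  obtain ⟨hs', hmarks'⟩ := hP R δ₀ hδ₀ hs hmarks q hq
  refine hIa R (δ₀ / (q : ℝ)) (div_pos hδ₀ hq0) hs' hmarks' φ x hφ L ?_
  have heq : (fun k : ℕ => Literature.Probability.Percolation.bondDomainCrossingProb R (δ₀ / (q : ℝ) / 2 ^ k)) =
      fun k : ℕ => Literature.Probability.Percolation.bondDomainCrossingProb R (δ₀ / ((q : ℝ) * 2 ^ k)) := by
    funext k
    rw [div_div]
  rw [heq]
  exact hL

/-- **The assembly** — hypotheses = the registered stub `Prop`s BY NAME, conclusion = the crux BY NAME: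
`Stubs.stub_dyadicLimitExists → Stubs.stub_dyadicLimitIsBetaLaw → CardyTensorRG.PolyominoGaussianLaw`
(skeleton v6 — the proof IS the landed reduction `stub_reductionToDyadic` (p151231); the mesh-equicontinuity stubs `stub_dilatedCopy`, `stub_scalingIdentity`,
`stub_dilationEquicontinuity` and the refinement stub `stub_polyominoRefinement` are theorems of the tree;
refinement turns the dyadic orbits of all representations into all blocking orbits `δ₀/(q·2^k)` of one).
Existence along every blocking orbit + identification of each orbit limit as `I_a(η)` give a COMMON limit
along all orbits `δ₀/(q·2^k)`; the log-scale net lemma `tendsto_nhdsWithin_zero_of_orbits` and mesh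
equicontinuity upgrade it to the full one-sided limit `δ → 0⁺`, i.e. `R.HasCrossingLimit … I_a`. -/
theorem PolyominoGaussianLaw_of (hE' : Stubs.stub_dyadicLimitExists)
    (hI' : Stubs.stub_dyadicLimitIsBetaLaw) :
    Summit.CriticalPhenomena.CardyFormulaZ2.Theses.CardyTensorRG.PolyominoGaussianLaw :=
  stub_reductionToDyadic hE' hI'


/-- The skeleton IS the crux proof once the remaining registered stubs are discharged: the spelled-out stub
signatures are definitionally the named `Prop`s (an `example`, so that `PolyominoGaussianLaw_of` stays the
file's only theorem concluding the crux). -/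
example : Summit.CriticalPhenomena.CardyFormulaZ2.Theses.CardyTensorRG.PolyominoGaussianLaw :=
  PolyominoGaussianLaw_of stub_dyadicLimitExists stub_dyadicLimitIsBetaLaw

/-- Sanity check (v5): the landed theorems ARE the stub `Prop`s 3–6 and v1's mesh equicontinuity, definitionally. -/
example : Stubs.stub_dilatedCopy ∧ Stubs.stub_scalingIdentity ∧ Stubs.stub_dilationEquicontinuity ∧
    Stubs.stub_polyominoRefinement ∧ Stubs.meshEquicontinuity :=
  ⟨stub_dilatedCopy, stub_scalingIdentity, stub_dilationEquicontinuity, stub_polyominoRefinement,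
    stub_meshEquicontinuity⟩

/-- (c2) The cut is lossless: the crux is EQUIVALENT to the two registered cores. -/
example : Summit.CriticalPhenomena.CardyFormulaZ2.Theses.CardyTensorRG.PolyominoGaussianLaw ↔
    (Stubs.stub_dyadicLimitExists ∧ Stubs.stub_dyadicLimitIsBetaLaw) :=
  stub_dyadicCutLossless

/-- (c2) Under the route's hypothesis `CardyRigidity` the crux is the shape-free universal dyadic law. -/
example (hR : Summit.CriticalPhenomena.CardyFormulaZ2.Theses.CardyTensorRG.CardyRigidity) :
    Summit.CriticalPhenomena.CardyFormulaZ2.Theses.CardyTensorRG.PolyominoGaussianLaw ↔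
      ∃ F : ℝ → ℝ, ContinuousOn F (Set.Ioo 0 1) ∧
        ∀ R : Literature.Probability.RandomPlanarGeometry.ConformalRectangle, ∀ δ₀ : ℝ, 0 < δ₀ →
        (∃ s : Finset (ℤ × ℤ), R.carrier = interior (⋃ p ∈ s, {z : ℂ | δ₀ * (p.1 : ℝ) ≤ z.re ∧
          z.re ≤ δ₀ * ((p.1 : ℝ) + 1) ∧ δ₀ * (p.2 : ℝ) ≤ z.im ∧ z.im ≤ δ₀ * ((p.2 : ℝ) + 1)})) →
        (∀ i, ∃ m n : ℤ, R.pt i = (δ₀ : ℂ) * ((m : ℂ) + (n : ℂ) * Complex.I)) →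
        ∀ (φ : Literature.Probability.RandomPlanarGeometry.ConformalEquiv UpperHalfPlane.upperHalfPlaneSet R.carrier)
          (x : Fin 4 → ℝ), R.IsUniformizing φ x →
        Filter.Tendsto
          (fun k : ℕ => Literature.Probability.Percolation.bondDomainCrossingProb R (δ₀ / 2 ^ k))
          Filter.atTop (nhds (F (Literature.Probability.RandomPlanarGeometry.crossRatio x))) :=
  stub_dyadicUniversalLawIff hR

/-- (c2) The lattice theorem behind the square instance: `P_{1/2}(LR crossing of the n × n box) → 1/2`. -/
example : Filter.Tendsto (fun n : ℕ => Literature.Probability.Percolation.crossingProb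
    Literature.Probability.Percolation.half n n) Filter.atTop (nhds (1 / 2)) :=
  sq_tendsto_crossingProb_self

/-! ### (c3, v8) What the auxiliary stubs give for the two cores (sorry-free glue) -/

/-! (`tendsto_dyadicMesh : Tendsto (fun k => δ₀ / 2 ^ k) atTop (𝓝[>] 0)` is in the tree, `…DyadicCores.lean`.) -/

/-- **Both cores hold on the lattice-symmetric class** (from aux stubs 7–8): for a conformal rectangle
with an anti-linear lattice symmetry exchanging the arc pairs, fixing the marks `a, c` and sending `b ↦ d`,
every dyadic orbit converges (core E, with limit `1/2`), and for EVERY `a < 1` every dyadic limit is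
`I_a(cross-ratio)` (core I, every exponent) — in particular for every lattice-symmetric POLYOMINO quad. -/
theorem symmetricClass_cores (h7 : Stubs.stub_symmetricClassBetaLaw) (h8 : Stubs.stub_symmetricClassDyadic)
    (R : Literature.Probability.RandomPlanarGeometry.ConformalRectangle) (u : ℂ)
    (hu : u = 1 ∨ u = -1 ∨ u = Complex.I ∨ u = -Complex.I)
    (hΩ : (fun z : ℂ => u * (starRingEnd ℂ) z) '' R.carrier = R.carrier)
    (harcs : (fun z : ℂ => u * (starRingEnd ℂ) z) '' R.arc 0 = R.arc 1 ∧
          (fun z : ℂ => u * (starRingEnd ℂ) z) '' R.arc 2 = R.arc 3 ∨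
        (fun z : ℂ => u * (starRingEnd ℂ) z) '' R.arc 0 = R.arc 3 ∧
          (fun z : ℂ => u * (starRingEnd ℂ) z) '' R.arc 2 = R.arc 1)
    (h0 : u * (starRingEnd ℂ) (R.pt 0) = R.pt 0) (h2 : u * (starRingEnd ℂ) (R.pt 2) = R.pt 2)
    (h1 : u * (starRingEnd ℂ) (R.pt 1) = R.pt 3) {δ₀ : ℝ} (hδ₀ : 0 < δ₀) :
    (∃ L : ℝ, Filter.Tendsto
        (fun k : ℕ => Literature.Probability.Percolation.bondDomainCrossingProb R (δ₀ / 2 ^ k))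
        Filter.atTop (nhds L)) ∧
    ∀ a : ℝ, a < 1 →
      ∀ (φ : Literature.Probability.RandomPlanarGeometry.ConformalEquiv UpperHalfPlane.upperHalfPlaneSet R.carrier)
        (x : Fin 4 → ℝ), R.IsUniformizing φ x →
      ∀ L : ℝ, Filter.Tendsto
        (fun k : ℕ => Literature.Probability.Percolation.bondDomainCrossingProb R (δ₀ / 2 ^ k))
        Filter.atTop (nhds L) →
        L = intervalIntegral (fun s : ℝ => (s * (1 - s)) ^ (-a)) 0
              (Literature.Probability.RandomPlanarGeometry.crossRatio x) MeasureTheory.volume /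
            intervalIntegral (fun s : ℝ => (s * (1 - s)) ^ (-a)) 0 1 MeasureTheory.volume := by
  refine ⟨⟨1 / 2, h8 R u hu hΩ harcs δ₀ hδ₀⟩, fun a ha φ x hφ L hL => ?_⟩
  have hfull := h7 R u hu hΩ harcs h0 h2 h1 a ha φ x hφ
  exact tendsto_nhds_unique hL (hfull.comp (tendsto_dyadicMesh hδ₀))

/-- **Core E is closed under cyclic re-marking** (from aux stub 9), in the vocabulary of
`stub_dyadicLimitExists`: a polyomino representation of `R` with lattice marks is one of `R⁺` (same carrier,
marks permuted), and the dyadic orbit of `R⁺` converges whenever that of `R` does. -/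
theorem dyadicLimitExists_shift (h9 : Stubs.stub_coresShiftClosed)
    (R R' : Literature.Probability.RandomPlanarGeometry.ConformalRectangle) (hc : R'.carrier = R.carrier)
    (hpt : ∀ i, R'.pt i = R.pt (i + 1)) (ha0 : R'.arc 0 = R.arc 1) (ha2 : R'.arc 2 = R.arc 3)
    {δ₀ : ℝ} (hδ₀ : 0 < δ₀)
    (hE : ∃ L : ℝ, Filter.Tendsto
      (fun k : ℕ => Literature.Probability.Percolation.bondDomainCrossingProb R (δ₀ / 2 ^ k))
      Filter.atTop (nhds L)) :
    ∃ L' : ℝ, Filter.Tendsto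
      (fun k : ℕ => Literature.Probability.Percolation.bondDomainCrossingProb R' (δ₀ / 2 ^ k))
      Filter.atTop (nhds L') := by
  obtain ⟨L, hL⟩ := hE
  exact ⟨1 - L, (h9 R R' hc hpt ha0 ha2 δ₀ hδ₀).1 L hL⟩

/-- **Core I is closed under cyclic re-marking** (from aux stub 9), in the vocabulary of
`stub_dyadicLimitIsBetaLaw` (same exponent `a` on both sides). -/
theorem dyadicLimitIsBetaLaw_shift (h9 : Stubs.stub_coresShiftClosed) {a : ℝ} (ha : a < 1)
    (R R' : Literature.Probability.RandomPlanarGeometry.ConformalRectangle) (hc : R'.carrier = R.carrier)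
    (hpt : ∀ i, R'.pt i = R.pt (i + 1)) (ha0 : R'.arc 0 = R.arc 1) (ha2 : R'.arc 2 = R.arc 3)
    {δ₀ : ℝ} (hδ₀ : 0 < δ₀)
    (hI : ∀ (φ : Literature.Probability.RandomPlanarGeometry.ConformalEquiv UpperHalfPlane.upperHalfPlaneSet R.carrier)
        (x : Fin 4 → ℝ), R.IsUniformizing φ x →
      ∀ L : ℝ, Filter.Tendsto
        (fun k : ℕ => Literature.Probability.Percolation.bondDomainCrossingProb R (δ₀ / 2 ^ k))
        Filter.atTop (nhds L) →
        L = intervalIntegral (fun s : ℝ => (s * (1 - s)) ^ (-a)) 0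
              (Literature.Probability.RandomPlanarGeometry.crossRatio x) MeasureTheory.volume /
            intervalIntegral (fun s : ℝ => (s * (1 - s)) ^ (-a)) 0 1 MeasureTheory.volume) :
    ∀ (φ' : Literature.Probability.RandomPlanarGeometry.ConformalEquiv UpperHalfPlane.upperHalfPlaneSet R'.carrier)
      (x' : Fin 4 → ℝ), R'.IsUniformizing φ' x' →
    ∀ L' : ℝ, Filter.Tendsto
      (fun k : ℕ => Literature.Probability.Percolation.bondDomainCrossingProb R' (δ₀ / 2 ^ k))
      Filter.atTop (nhds L') →
      L' = intervalIntegral (fun s : ℝ => (s * (1 - s)) ^ (-a)) 0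
            (Literature.Probability.RandomPlanarGeometry.crossRatio x') MeasureTheory.volume /
          intervalIntegral (fun s : ℝ => (s * (1 - s)) ^ (-a)) 0 1 MeasureTheory.volume :=
  (h9 R R' hc hpt ha0 ha2 δ₀ hδ₀).2 a ha hI

/-- The re-marked rectangle `R⁺` of aux stub 9 exists for every `R` (tree: `MeckeFlipBridge.exists_shift1`),
so the closure statements are not vacuous. [folklore] -/
example (R : Literature.Probability.RandomPlanarGeometry.ConformalRectangle) :
    ∃ R' : Literature.Probability.RandomPlanarGeometry.ConformalRectangle, R'.carrier = R.carrier ∧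
      (∀ i, R'.pt i = R.pt (i + 1)) ∧ R'.arc 0 = R.arc 1 ∧ R'.arc 2 = R.arc 3 := by
  obtain ⟨R', hc, hp, h0, -, h2, -⟩ := Summit.CriticalPhenomena.CardyFormulaZ2.Theorems.MeckeFlipBridge.exists_shift1 R
  exact ⟨R', hc, hp, h0, h2⟩

end Summit.CriticalPhenomena.CardyFormulaZ2.Cruxes.PolyominoGaussianLaw.Birth
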